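import Summits.SmoothPoincare4.SmoothPoincare4.Theorems.ConvexBisectionAcyclicBisectionExistsCrossingNumberGenerators
import Summits.SmoothPoincare4.SmoothPoincare4.Theorems.ConvexBisectionAcyclicBisectionExistsDualLinkFraming
import HarnessLib

/-!
# Seam transport, ST4 (4c, inputs): pages off the cores and rotation arcs in the flat part of `∂ Base g`
(wave 5, brick X3-4a of sub-node ST4 `node_ST4_twistSign` of node T3c-2 `node_seam_transport` of stub
`stub_T3_dualPresentation` (T3), line `modp-braid-orbits`, crux `ConvexBisection.AcyclicBisectionExists`,
item stmt-SmoothPoincare4-10508; registered sub-goal `helper_exists_mem_page_coresComplement`)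

The twisting sign of ST4 is a locally constant function on the set `flatOff h` of flat page points of
`∂ Base g` (the union of the pages `page g c`, `‖c‖ = 1`) OFF THE CORES of a Lefschetz link `h`
(`IsLefschetzLink g l h`: the `k`-th core lies in the page of direction `pageDir |l| k`).  The sequel
`…SeamTwistSignConnected.lean` proves that `flatOff h` is preconnected; this file supplies the inputs:

* §1 `flatOff h`; every page is preconnected (`pathConnectedSpace_page_of_norm`, Z6) and the
  non-critical pages lie in `flatOff h` (cores sit in critical pages, distinct directions have disjoint
  pages);
* §2 EVERY page, critical or not, has a point off the cores (`exists_mem_page_not_mem_cores`, registered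
  as `helper_exists_mem_page_coresComplement`): a page is not closed in `ℝ⁴` (the probe path
  `s ↦ (2s, √((2s)^{2g+1} + 1 + c/2))`, `s ↑ 1`, leaves it), while a core is compact;
* §3 the rigid page rotation `Rot_s` (`helper_rotFlow_page` with unit profile) moves a point of
  `page g c` through the pages `page g (e^{is} c)`; a point of `flatOff h` stays in `flatOff h` for
  `|s| < ε` (`exists_rot_arc`: finitely many critical directions), and such an arc lies in one
  component of `flatOff h`.

Everything is proved; no named facts, no `sorry`.  References: J. B. Etnyre, T. Fuller, IMRN 2006,
Thm. 1 (proof, p. 8) [EtnyreFuller2006]; J. Milnor, *Singular points of complex hypersurfaces* (1968),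
§9 [Milnor1968].
-/

noncomputable section

set_option linter.dupNamespace false

open scoped Manifold ContDiff Topology Real

namespace Summit.SmoothPoincare4.SmoothPoincare4.Theorems.AcyclicBisectionExists.ModpBraidOrbits

open Set Function Filter Metric Complex
open Literature.Topology.FourManifolds Literature.Topology.FourManifolds.HandleAttachingMap
  Literature.Topology.FourManifolds.LefschetzBase

variable {g : ℕ}

/-! ## §1 Flat page points off the cores -/

/-- **The flat part of `∂ Base g` off the cores**: the points of the pages `page g c` (`‖c‖ = 1`) not
on any core of the link `h`. [cite: EtnyreFuller2006, Thm. 1 (proof, p. 8)] -/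
def flatOff {ι : Type} [Finite ι] (h : ι → HandleAttachingMap 3 2 (Base g)) : Set (Base g) :=
  {q | ∃ c : ℂ, ‖c‖ = 1 ∧ q ∈ page g c} ∩ (coresComplement h : Set (Base g))

/-- A page of unit direction is preconnected (it is path connected, Z6). [cite: Milnor1968, §9 Lemma 9.2] -/
theorem isPreconnected_page {c : ℂ} (hc : ‖c‖ = 1) : IsPreconnected (page g c) := by
  haveI := pathConnectedSpace_page_of_norm g hc
  exact (isPathConnected_iff_pathConnectedSpace.2 inferInstance).isConnected.isPreconnected

/-- The direction of a page is determined by any of its points: `c = 2 w`. [folklore] -/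
theorem eq_of_mem_page {c c' : ℂ} {q : Base g} (hq : q ∈ page g c) (hq' : q ∈ page g c') : c = c' := by
  have h1 : w g q.1 = c / 2 := hq.2
  have h2 : w g q.1 = c' / 2 := hq'.2
  linear_combination 2 * h2 - 2 * h1

section Link

variable {l : List ((Fin g ⊕ Fin g → ℤ) × Bool)} {h : Fin l.length → HandleAttachingMap 3 2 (Base g)}
  (hlink : IsLefschetzLink g l h)

include hlink in
/-- A point of a core lies in the critical page of its index. [cite: EtnyreFuller2006, §2] -/
theorem mem_page_of_mem_core {k : Fin l.length} {q : Base g} (hq : q ∈ (h k).core) :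
    q ∈ page g (pageDir l.length k) := by
  rw [← range_attachingCircle] at hq
  obtain ⟨θ, rfl⟩ := hq
  exact hlink.mem_page k θ

include hlink in
/-- **A page of non-critical direction lies off the cores.** [cite: EtnyreFuller2006, §2] -/
theorem mem_coresComplement_of_mem_page {c : ℂ} (hcrit : ∀ k : Fin l.length, c ≠ pageDir l.length k)
    {q : Base g} (hq : q ∈ page g c) : q ∈ (coresComplement h : Set (Base g)) := by
  rw [SetLike.mem_coe, mem_coresComplement]
  intro k hk
  exact hcrit k (eq_of_mem_page hq (mem_page_of_mem_core hlink hk))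

include hlink in
/-- A page of non-critical unit direction lies in `flatOff h`. [folklore] -/
theorem page_subset_flatOff {c : ℂ} (hc : ‖c‖ = 1) (hcrit : ∀ k : Fin l.length, c ≠ pageDir l.length k) :
    page g c ⊆ flatOff h := fun _ hq =>
  ⟨⟨c, hc, hq⟩, mem_coresComplement_of_mem_page hlink hcrit hq⟩

/-! ## §2 Every page has a point off the cores -/

/-- The probe path `s ↦ (2s, √((2s)^{2g+1} + 1 + c/2))` of `ℂ²`. [folklore] -/
theorem continuousOn_probe {c : ℂ} (hc : ‖c‖ = 1) :
    ContinuousOn (fun s : ℝ => LefschetzBase.mk (2 * s : ℂ) (csqrt ((2 * s : ℂ) ^ (2 * g + 1) + 1 + c / 2)))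
      (Icc 0 1) := by
  have hre : ∀ s ∈ Icc (0 : ℝ) 1, 0 ≤ ((2 * s : ℂ) ^ (2 * g + 1) + 1 + c / 2).re := by
    intro s hs
    have h1 : ((2 * s : ℂ) ^ (2 * g + 1)).re = (2 * s) ^ (2 * g + 1) := by
      rw [show ((2 * s : ℂ)) = ((2 * s : ℝ) : ℂ) by push_cast; rfl, ← Complex.ofReal_pow, Complex.ofReal_re]
    have h2 : |(c / 2).re| ≤ 1 / 2 := by
      have h := Complex.abs_re_le_norm (c / 2)
      rwa [norm_div, hc, Complex.norm_two] at h
    have h3 : (0 : ℝ) ≤ (2 * s) ^ (2 * g + 1) := pow_nonneg (by linarith [hs.1]) _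
    rw [Complex.add_re, Complex.add_re, h1, Complex.one_re]
    linarith [abs_le.1 h2]
  have hpoly : Continuous fun s : ℝ => (2 * s : ℂ) ^ (2 * g + 1) + 1 + c / 2 :=
    ((continuous_const.mul Complex.continuous_ofReal).pow _).add continuous_const |>.add continuous_const
  refine continuous_mk.comp_continuousOn ((continuous_const.mul Complex.continuous_ofReal).continuousOn.prodMk ?_)
  intro s hs
  show ContinuousWithinAt (csqrt ∘ fun s : ℝ => (2 * s : ℂ) ^ (2 * g + 1) + 1 + c / 2) (Icc 0 1) s
  exact ContinuousAt.comp_continuousWithinAt (f := fun r : ℝ => (2 * r : ℂ) ^ (2 * g + 1) + 1 + c / 2)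
    (x := s) (continuousAt_csqrt (hre s hs)) hpoly.continuousWithinAt

/-- The probe path has `w = c/2`. [folklore] -/
theorem w_probe (c : ℂ) (s : ℝ) :
    w g (LefschetzBase.mk (2 * s : ℂ) (csqrt ((2 * s : ℂ) ^ (2 * g + 1) + 1 + c / 2))) = c / 2 := by
  simp only [w, Phi, cx_mk, cy_mk, csqrt_sq]
  ring

include hlink in
/-- **Every page has a point off the cores.**  For a critical page this is because a page of unit
direction is not closed in `ℝ⁴` (the probe path leaves it as `‖x‖² ↑ 4`) whereas a core is compact, and
only the core of the page's own index can lie in it. [cite: Milnor1968, §9] -/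
theorem exists_mem_page_not_mem_cores {c : ℂ} (hc : ‖c‖ = 1) :
    ∃ q ∈ page g c, q ∈ (coresComplement h : Set (Base g)) := by
  by_contra H
  push Not at H
  -- points of the page, from the probe path
  set P : ℝ → EuclideanSpace ℝ (Fin 4) :=
    fun s => LefschetzBase.mk (2 * s : ℂ) (csqrt ((2 * s : ℂ) ^ (2 * g + 1) + 1 + c / 2)) with hP
  have hPx : ∀ s : ℝ, ‖cx (P s)‖ ^ 2 = 4 * s ^ 2 := fun s => by
    simp only [hP, cx_mk]
    rw [show ((2 * s : ℂ)) = ((2 * s : ℝ) : ℂ) by push_cast; rfl, Complex.norm_real, Real.norm_eq_abs,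
      sq_abs]
    ring
  have hPmem : ∀ s ∈ Ico (0 : ℝ) 1, ∃ q ∈ page g c, q.1 = P s := by
    intro s hs
    have hx : ‖cx (P s)‖ ^ 2 < 4 := by rw [hPx]; nlinarith [hs.1, hs.2]
    have hρ : rho g (P s) = 1 / 4 := by
      rw [rho, w_probe, eta_of_le hx.le, norm_div, hc]; norm_num
    exact ⟨⟨P s, by rw [Set.mem_preimage, Set.mem_Iic, hρ]⟩, ⟨hx, w_probe c s⟩, rfl⟩
  -- the page is contained in one core
  obtain ⟨q₀, hq₀, hq₀P⟩ := hPmem 0 ⟨le_rfl, zero_lt_one⟩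
  have hq₀c : ∃ k, q₀ ∈ (h k).core := by
    have := H q₀ hq₀
    rw [SetLike.mem_coe, mem_coresComplement] at this
    push Not at this
    exact this
  obtain ⟨k₀, hk₀⟩ := hq₀c
  have hck : c = pageDir l.length k₀ := eq_of_mem_page hq₀ (mem_page_of_mem_core hlink hk₀)
  have hsub : page g c ⊆ (h k₀).core := by
    intro q hq
    have := H q hq
    rw [SetLike.mem_coe, mem_coresComplement] at this
    push Not at this
    obtain ⟨k, hk⟩ := this
    have hck' : c = pageDir l.length k := eq_of_mem_page hq (mem_page_of_mem_core hlink hk)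
    have : k = k₀ := Fin.ext (pageDir_injOn k.2 k₀.2 (hck'.symm.trans hck))
    rw [← this]; exact hk
  -- so its image in `ℝ⁴` is closed
  have hclosed : IsClosed (Subtype.val '' page g c : Set (EuclideanSpace ℝ (Fin 4))) := by
    have heq : page g c = (h k₀).core := by
      refine Subset.antisymm hsub fun q hq => ?_
      have := mem_page_of_mem_core hlink hq
      rwa [← hck] at this
    rw [heq]
    exact ((h k₀).isCompact_core.image continuous_subtype_val).isClosed
  -- but the probe path leaves it at `s = 1`
  have hlim : P 1 ∈ closure (Subtype.val '' page g c : Set (EuclideanSpace ℝ (Fin 4))) := by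
    have hcont : ContinuousWithinAt P (Ico 0 1) 1 :=
      ((continuousOn_probe (g := g) hc) 1 ⟨zero_le_one, le_rfl⟩).mono Ico_subset_Icc_self
    haveI : (𝓝[Ico (0 : ℝ) 1] (1 : ℝ)).NeBot := by
      apply mem_closure_iff_nhdsWithin_neBot.mp
      rw [closure_Ico zero_ne_one]
      exact ⟨zero_le_one, le_rfl⟩
    refine mem_closure_of_tendsto hcont.tendsto ?_
    filter_upwards [self_mem_nhdsWithin] with s hs
    obtain ⟨q, hq, hqs⟩ := hPmem s hs
    exact ⟨q, hq, hqs⟩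
  rw [hclosed.closure_eq] at hlim
  obtain ⟨q, hq, hq1⟩ := hlim
  have := hq.1
  rw [hq1, hPx] at this
  norm_num at this

end Link

/-! ## §3 Rotation arcs -/

/-- **The rigid page rotation**: an ambient isotopy `Rot` of `Base g` with
`Rot_s (page g c) ⊆ page g (e^{is} c)` (`helper_rotFlow_page` with unit angular speed). [folklore] -/
theorem exists_pageRotation (g : ℕ) : ∃ Rot : AmbientIsotopy (𝓡∂ 4) (Base g),
    ∀ (x : Base g) (c : ℂ) (s : ℝ), x ∈ page g c → Rot.toFun s x ∈ page g (Complex.exp (Complex.I * s) * c) := by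
  obtain ⟨Rot, -, -, -, -, -, -, -, -, -, hrot⟩ := helper_rotFlow_page g (fun _ => (1 : ℝ)) contDiff_const
  refine ⟨Rot, fun x c s hx => ?_⟩
  have := hrot 1 (fun _ => rfl) x c s hx
  simpa using this

/-- Finitely many directions are avoided by all small non-zero rotations of `c`. [folklore] -/
theorem eventually_rot_ne {ι : Type} [Finite ι] (d : ι → ℂ) (c : ℂ) (hc : ‖c‖ = 1) :
    ∀ᶠ s : ℝ in 𝓝 0, s ≠ 0 → ∀ k, Complex.exp (Complex.I * s) * c ≠ d k := by
  have hk : ∀ k, ∀ᶠ s : ℝ in 𝓝 0, s ≠ 0 → Complex.exp (Complex.I * s) * c ≠ d k := by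
    intro k
    by_cases hdk : d k = c
    · -- `e^{is} c = c` forces `s ∈ 2πℤ`
      have hI : Ioo (-(2 * π)) (2 * π) ∈ 𝓝 (0 : ℝ) :=
        Ioo_mem_nhds (by linarith [Real.pi_pos]) (by linarith [Real.pi_pos])
      filter_upwards [hI] with s hs hs0 heq
      rw [hdk] at heq
      have hc0 : c ≠ 0 := by rintro rfl; simp at hc
      have h1 : Complex.exp (Complex.I * s) = 1 := by
        have := mul_right_cancel₀ hc0 (heq.trans (one_mul c).symm)
        exact this
      obtain ⟨n, hn⟩ := Complex.exp_eq_one_iff.1 h1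
      have hs_eq : s = n * (2 * π) := by
        have := congrArg Complex.im hn
        simp at this
        linarith
      rcases lt_trichotomy n 0 with hn0 | hn0 | hn0
      · have : (n : ℝ) ≤ -1 := by exact_mod_cast Int.le_sub_one_of_lt hn0
        nlinarith [hs.1, Real.pi_pos]
      · rw [hn0] at hs_eq; simp at hs_eq; exact hs0 hs_eq
      · have : (1 : ℝ) ≤ n := by exact_mod_cast hn0
        nlinarith [hs.2, Real.pi_pos]
    · have hcont : ContinuousAt (fun s : ℝ => Complex.exp (Complex.I * s) * c) 0 :=
        ((Complex.continuous_exp.comp (continuous_const.mul Complex.continuous_ofReal)).mul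
          continuous_const).continuousAt
      have h0 : (fun s : ℝ => Complex.exp (Complex.I * s) * c) 0 ≠ d k := by
        simp only [Complex.ofReal_zero, mul_zero, Complex.exp_zero, one_mul]
        exact Ne.symm hdk
      filter_upwards [hcont.eventually_ne h0] with s hs _
      exact hs
  filter_upwards [Filter.eventually_all.2 hk] with s hs hs0 k
  exact hs k hs0

section Arcs

variable {l : List ((Fin g ⊕ Fin g → ℤ) × Bool)} {h : Fin l.length → HandleAttachingMap 3 2 (Base g)}
  (hlink : IsLefschetzLink g l h) (Rot : AmbientIsotopy (𝓡∂ 4) (Base g))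
  (hRot : ∀ (x : Base g) (c : ℂ) (s : ℝ), x ∈ page g c → Rot.toFun s x ∈ page g (Complex.exp (Complex.I * s) * c))

include hlink hRot in
/-- **Rotation arcs stay in `flatOff h` for a short time**: for `q ∈ flatOff h` there is `ε > 0` with
`Rot_s q ∈ flatOff h` for `|s| < ε`. [folklore] -/
theorem exists_rot_arc {q : Base g} (hq : q ∈ flatOff h) :
    ∃ ε : ℝ, 0 < ε ∧ ∀ s : ℝ, |s| < ε → Rot.toFun s q ∈ flatOff h := by
  obtain ⟨⟨c, hc, hqc⟩, hqcc⟩ := hq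
  obtain ⟨ε, hε, hball⟩ := Metric.eventually_nhds_iff.1
    (eventually_rot_ne (fun k : Fin l.length => pageDir l.length k) c hc)
  refine ⟨ε, hε, fun s hs => ?_⟩
  have hs' : dist s 0 < ε := by simpa using hs
  have hunit : ‖Complex.exp (Complex.I * s) * c‖ = 1 := by
    rw [norm_mul, hc, mul_one, show Complex.I * s = (s : ℂ) * Complex.I by ring, Complex.norm_exp_ofReal_mul_I]
  by_cases hs0 : s = 0
  · subst hs0
    rw [Rot.map_zero]
    exact ⟨⟨c, hc, hqc⟩, hqcc⟩
  · exact page_subset_flatOff hlink hunit (hball hs' hs0) (hRot q c s hqc)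

omit hlink hRot in
/-- **A rotation arc inside `flatOff h` lies in the component of its start.** [folklore] -/
theorem rot_arc_subset_component {q : Base g} {ε : ℝ} (harc : ∀ s : ℝ, |s| < ε → Rot.toFun s q ∈ flatOff h)
    {s₀ : ℝ} (hs₀ : |s₀| < ε) :
    (fun s => Rot.toFun s q) '' uIcc 0 s₀ ⊆ connectedComponentIn (flatOff h) q := by
  have hAc : IsPreconnected ((fun s => Rot.toFun s q) '' uIcc 0 s₀) :=
    isPreconnected_uIcc.image _ ((Rot.contMDiff.continuous.comp
      (continuous_id.prodMk continuous_const)).continuousOn)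
  have hAsub : (fun s => Rot.toFun s q) '' uIcc 0 s₀ ⊆ flatOff h := by
    rintro _ ⟨s, hs, rfl⟩
    refine harc s (lt_of_le_of_lt ?_ hs₀)
    rcases le_total 0 s₀ with h0 | h0
    · rw [uIcc_of_le h0] at hs; rw [abs_of_nonneg hs.1, abs_of_nonneg h0]; exact hs.2
    · rw [uIcc_of_ge h0] at hs; rw [abs_of_nonpos hs.2, abs_of_nonpos h0]; linarith [hs.1]
  have h0 : q ∈ (fun s => Rot.toFun s q) '' uIcc 0 s₀ :=
    ⟨0, left_mem_uIcc, by show Rot.toFun 0 q = q; rw [Rot.map_zero]; rfl⟩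
  exact hAc.subset_connectedComponentIn h0 hAsub

omit hlink hRot in
/-- The endpoint of a rotation arc inside `flatOff h` lies in the component of the start. [folklore] -/
theorem rot_mem_component {q x : Base g} {ε : ℝ} (harc : ∀ s : ℝ, |s| < ε → Rot.toFun s q ∈ flatOff h)
    {s₀ : ℝ} (hs₀ : |s₀| < ε) (hq : q ∈ connectedComponentIn (flatOff h) x) :
    Rot.toFun s₀ q ∈ connectedComponentIn (flatOff h) x := by
  rw [connectedComponentIn_eq hq]
  exact rot_arc_subset_component Rot harc hs₀ ⟨s₀, right_mem_uIcc, rfl⟩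

omit hlink hRot in
/-- The start of a rotation arc inside `flatOff h` lies in the component of the endpoint. [folklore] -/
theorem mem_component_of_rot {q x : Base g} {ε : ℝ} (harc : ∀ s : ℝ, |s| < ε → Rot.toFun s q ∈ flatOff h)
    {s₀ : ℝ} (hs₀ : |s₀| < ε) (hx : Rot.toFun s₀ q ∈ connectedComponentIn (flatOff h) x) :
    q ∈ connectedComponentIn (flatOff h) x := by
  have hε : 0 < ε := lt_of_le_of_lt (abs_nonneg _) hs₀
  have hq : q ∈ flatOff h := by
    have := harc 0 (by rw [abs_zero]; exact hε)
    rwa [Rot.map_zero] at this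
  have h1 : Rot.toFun s₀ q ∈ connectedComponentIn (flatOff h) q :=
    rot_arc_subset_component Rot harc hs₀ ⟨s₀, right_mem_uIcc, rfl⟩
  rw [connectedComponentIn_eq hx, ← connectedComponentIn_eq h1]
  exact mem_connectedComponentIn hq

end Arcs

/-- **Sub-goal `helper_exists_mem_page_coresComplement` of stub `stub_T3_dualPresentation`** (T3 ▸ T3c-2 ▸
ST4 `node_ST4_twistSign`, brick X3-4a (4c, input); wave 5, lead c5): for a Lefschetz link `h` on the base,
EVERY page `page g c` (`‖c‖ = 1`), critical or not, contains a point off the cores (a page is not closed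
in `ℝ⁴`, a core is compact, and only the core of the page's own index can lie in a critical page).
[cite: Milnor1968, §9] -/
theorem helper_exists_mem_page_coresComplement : ∀ (g : ℕ) (l : List ((Fin g ⊕ Fin g → ℤ) × Bool)) (h : Fin l.length → Literature.Topology.FourManifolds.HandleAttachingMap 3 2 (Literature.Topology.FourManifolds.LefschetzBase.Base g)), Literature.Topology.FourManifolds.LefschetzBase.IsLefschetzLink g l h → ∀ (c : ℂ), ‖c‖ = 1 → ∃ q ∈ Literature.Topology.FourManifolds.LefschetzBase.page g c, q ∈ (Literature.Topology.FourManifolds.HandleAttachingMap.coresComplement h : Set (Literature.Topology.FourManifolds.LefschetzBase.Base g)) :=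
  fun _ _ _ hlink _ hc => exists_mem_page_not_mem_cores hlink hc

end Summit.SmoothPoincare4.SmoothPoincare4.Theorems.AcyclicBisectionExists.ModpBraidOrbits

end
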